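import Summits.QuantumAdvantage.QuantumAdvantage.Theorems.CharDialTokenDialS
import Summits.QuantumAdvantage.QuantumAdvantage.Theorems.CharDialTokenDialL
import HarnessLib

/-!
# WalkHardFJLinOdd — the token dial, part T: the PURE-FORM CORE and its LAZY TWIN inside the LOW piece, by name

Cell `decomp-qadv`, lens 6, generation 19 (census supplement to part S).  `pureFormY a H` is the pure-form strategy (cut `g` plays `H g` on the
form `Σ_i a g i·u_i`; juntas empty) and `TowerDefs.FormHard` is `T` restricted to pure-form strategies; `TowerDefs.LazyFormHard5` is the
bound for the PAIR LIFTS `twinLift a H` (part S) whose presentations escape the five presentation dials.  ★ `formHard_of_T` (trivial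
restriction) and ★★ `lazyFormHard5_of_jlinLowResidual5`: the filed LOW piece (item 27206) IMPLIES `LazyFormHard5` — by part S the lift is
JLin and LOW at `dialB`, so 27206 applies to it verbatim.  This is the by-name form of the census statement «the LOW piece contains the
lazy pure-form game» (CENSUS-g19-LIFT.md): any proof of 27206 proves the lazy ring game hard for every pure-form strategy outside the five
presentation dials.
-/

set_option autoImplicit false

open Finset

namespace Summit.QuantumAdvantage.AdviceFreeQNC0.JLinPeel

namespace TokenDial

variable {n p : ℕ}

/-- the PURE-FORM strategy of data `(a, H)`: cut `g` plays `H g` on the form `Σ_i a g i·u_i`. -/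
def pureFormY (a : Fin (n + 1) → Fin n → ZMod p) (H : Fin (n + 1) → ZMod p → Bool) : Fin (n + 1) → (Fin n → Bool) → Bool :=
  fun g u => H g (∑ i, if u i then a g i else 0)

/-- pure-form strategies are `JLinHyp`-presentable with empty juntas. -/
theorem pureFormY_jlin (a : Fin (n + 1) → Fin n → ZMod p) (H : Fin (n + 1) → ZMod p → Bool) :
    TowerDefs.JLinHyp p n (pureFormY a H) := fun g =>
  ⟨∅, by simp, a g, fun _ s => H g s, fun _ _ _ _ => rfl, fun _ => rfl⟩

end TokenDial

namespace TowerDefs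

/-- **the PURE-FORM CORE of T**: the ring game is hard for every pure-form strategy (juntas empty), every prime `p ≥ 5`, eventually,
uniformly in the charge. -/
def FormHard : Prop :=
  ∀ (p : ℕ) [Fact p.Prime], 5 ≤ p → ∃ θ : ℝ, θ < 1 ∧ ∃ n₀ : ℕ, ∀ n ≥ n₀, ∀ c : ℕ,
    ∀ (a : Fin (n + 1) → Fin n → ZMod p) (H : Fin (n + 1) → ZMod p → Bool),
      ((Finset.univ.filter fun u : Fin n → Bool => ringWinU c (TokenDial.pureFormY a H) u = true).card : ℝ) ≤ θ * (2 : ℝ) ^ n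

/-- **the LAZY PURE-FORM CORE (five-dial residual)**: the ring game on `2n` positions is hard for every PAIR LIFT `twinLift a H` (part S:
the lazy ring game played by pure-form strategies) all of whose `log₂(2n)`-junta presentations escape the five presentation dials. -/
def LazyFormHard5 : Prop :=
  ∀ (p : ℕ) [Fact p.Prime], 5 ≤ p → ∃ θ : ℝ, θ < 1 ∧ ∃ n₀ : ℕ, ∀ n ≥ n₀, ∀ c : ℕ,
    ∀ (a : Fin (n + 1) → Fin n → ZMod p) (H : Fin (n + 1) → ZMod p → Bool),
      (∀ D : JLinPeel.JLinData p (2 * n), D.strat = TokenDial.twinLift a H → (∀ g, (D.J g).card ≤ Nat.log 2 (2 * n)) →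
          ¬ SpanHyp D ∧ ¬ SparseHyp D ∧ ¬ BlockHyp D ∧ ¬ NullHyp D ∧ ¬ MaskHyp D) →
      ((Finset.univ.filter fun u : Fin (2 * n) → Bool => ringWinU c (TokenDial.twinLift a H) u = true).card : ℝ)
        ≤ θ * (2 : ℝ) ^ (2 * n)

end TowerDefs

namespace TokenDial

/-- ★ `T` gives its pure-form core (restriction to empty juntas). -/
theorem formHard_of_T (hT : Summit.QuantumAdvantage.QuantumAdvantage.Theses.CharDial.WalkHardFJLinOdd) : TowerDefs.FormHard := by
  intro p _ hp5
  obtain ⟨θ, hθ, n₀, hn₀⟩ := hT p hp5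
  exact ⟨θ, hθ, n₀, fun n hn c a H => hn₀ n hn c (pureFormY a H) (pureFormY_jlin a H)⟩

/-- ★★ **the LOW piece contains the lazy pure-form game**: item 27206 (`JLinLowResidual5 = LowResidual5Side dialB`) implies
`LazyFormHard5` — the pair lift is JLin (`twinLift_jlin`) and LOW at `dialB` (`twinLift_lowVar`), so the piece applies to it verbatim. -/
theorem lazyFormHard5_of_jlinLowResidual5
    (hL : Summit.QuantumAdvantage.QuantumAdvantage.Theses.CharDial.JLinLowResidual5) : TowerDefs.LazyFormHard5 := by
  intro p _ hp5
  obtain ⟨θ, hθ, n₀, hn₀⟩ := hL p hp5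
  refine ⟨θ, hθ, n₀, fun n hn c a H hesc => ?_⟩
  exact hn₀ (2 * n) (by omega) c (twinLift a H) (twinLift_jlin a H) (twinLift_lowVar a H TowerDefs.dialB) hesc

/-- the pair lift IS a pure-form strategy on `2n` positions: forms `twinForm a g`, tables `H (twinCut g)` at even cuts and `false` at odd
cuts. -/
theorem twinLift_eq_pureFormY {n p : ℕ} (a : Fin (n + 1) → Fin n → ZMod p) (H : Fin (n + 1) → ZMod p → Bool) :
    twinLift a H = pureFormY (fun g k => twinForm a g k)
      (fun g s => if g.val % 2 = 1 then false else H (twinCut g) s) := by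
  funext g u
  simp only [twinLift, pureFormY]

/-- ★ the pure-form core (at `2n` positions) gives the lazy core outright — no presentation escapes needed: `FormHard → LazyFormHard5`.
So `FormHard` sits above BOTH by-name statements (`formHard_of_T`, this, `lazyFormHard5_of_jlinLowResidual5`). -/
theorem lazyFormHard5_of_formHard (hF : TowerDefs.FormHard) : TowerDefs.LazyFormHard5 := by
  intro p _ hp5
  obtain ⟨θ, hθ, n₀, hn₀⟩ := hF p hp5
  refine ⟨θ, hθ, n₀, fun n hn c a H _ => ?_⟩
  rw [twinLift_eq_pureFormY]
  exact hn₀ (2 * n) (by omega) c _ _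

/-- ★ and `T` itself gives `LazyFormHard5` (directly: the lift is JLin). -/
theorem lazyFormHard5_of_T (hT : Summit.QuantumAdvantage.QuantumAdvantage.Theses.CharDial.WalkHardFJLinOdd) :
    TowerDefs.LazyFormHard5 := by
  intro p _ hp5
  obtain ⟨θ, hθ, n₀, hn₀⟩ := hT p hp5
  refine ⟨θ, hθ, n₀, fun n hn c a H _ => ?_⟩
  exact hn₀ (2 * n) (by omega) c (twinLift a H) (twinLift_jlin a H)

end TokenDial

end Summit.QuantumAdvantage.AdviceFreeQNC0.JLinPeel
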